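import Summits.HodgeConjecture.HodgeConjecture.Cruxes.BlochSeedDiscOne.DiamondLevelLaws

/-!
# CeilingUnitApex — the APEX CEILING-UNIT FAMILY `P{(h−2)I+ℓ_χ, hI, y, y′}` (`y, y′` pure letters): ABSENT from every static design in ◇_h
# by a TWO-STEP boundary certificate (KERNEL, every `h`, law-free), and the census fate of the same cells one diamond UP
(control g19 `plan-lens-HodgeAV-control`, lens «control»; crux `BlochSeedDiscOne` = H2 = item `stmt-HodgeConjecture-18881`;
memo `KSPAN-PEEL-g19.md` §15 next to this file; companion kernel file `DiamondRestrict.lean`)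

Token: `line stmt-HodgeConjecture-18881 Cruxes/BlochSeedDiscOne/Lines/birth.lean 814a6a70c14e831a stub_rung_pad4_seedAt`.

HONEST FRAMING.  Everything here is a statement about H₁-static first-order DESIGNS (`MConfig`: `InDiamond h`, `G1Closed`, `StaticH1`) of the
hsemireg census — research conditional in spirit on HC_CM, which enters NOWHERE (not even as a binder).  Nothing in this file proves or refutes
HC, HC_AV, HC_CM, H2 = `BlochSeedDiscOne`, (T₈), (T₁₀), `KAbsent` or any rung of the ladder.  Designs are not sheaves and not a seed.
Imports `DiamondLevelLaws` only (the sibling `CeilingFork.lean` is not built on the farm, so its §1–§3 lemmas `xplus_unit_fork`,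
`lift_of_ceilingUnit` and the unit-ceiling-letter geometry are RESTATED VERBATIM in §0 below, credited); no census inside any proof.

WHAT IS PROVED (kernel, every `h : ℤ`, no parity, no displayed law, no A2I⁻, no RULE D on the `N`-level):
* §1 `apexCeilingUnit_absent_of_secondChild` — THE SECOND-CHILD THEOREM: a `P`-cell `Z` with the unit ceiling letter `(h−2)I+ℓ_χ` on a slot `d`
  and the ceiling apex `hI` on a slot `f ≠ d`, for which some cell `Z'` agreeing with `Z` off `d` and carrying a DIFFERENT unit ceiling letter at `d`
  is present whenever `Z` is (in a `G₁`-closed design: `Z' = g • Z`, `g ∈ G₁ = ⟨S₄, Δ⟩`), is ABSENT from every two-level design with `InDiamond h`,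
  RULE D on the `P`-level and the X⁺ law.  CERTIFICATE (2 steps = the census's round-1 kill `P:Xp` with `nprop = 2`): RULE D (P) at the pair (apex
  at `f`, node `h−2` of the unit ceiling letter at `d`) forces the LIFT `X = Z(d ↦ hI) ∈ C.lower` as a `(χ+2)`-partner at distance one
  (`lift_of_ceilingUnit`); `Z'` is a SECOND distance-one child of `X` at `d` in the direction `χ'+2 ≠ χ+2`; `X d = X f = hI`; `xplus_unit_fork` ⇒ ⊥.
  Three sub-families with an explicit `g`: A `apexCeilingUnitFamily_absent` — every letter off `d` is `Δ`-fixed (pure letters `aI`), `Z' = Δ Z`;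
  B `antipodalPair_apexCeilingUnit_absent` — `P{x, Δ²x, (h−2)I+ℓ_χ, hI}` with `x` ARBITRARY, `Z' = (0 1) • Δ² Z`; C `adjacentCeilingPair_absent` —
  `P{aI, (h−2)I+ℓ_ψ, (h−2)I+ℓ_{ψ+3}, hI}`, `Z' = (1 2) • Δ³ Z`; each also `…_static` over `G1Closed` + `StaticH1`, and `apexTriple_absent_static`.
* §2 census representatives as instances: `P[4I+l-1|6I|6I|6I]` (◇₆), `P[6I+l-1|8I|8I|8I]`, `P[O|O|6I+l-1|8I]`, `P[l-1|l1|6I+l-1|8I]` (B),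
  `P[O|6I+l-1|6I+li|8I]` (C) (◇₈), `P[8I+l-1|10I|10I|10I]` (◇₁₀).

CENSUS (cited, never used in a proof; control g19 `tools/kfamily_apexcu*.py`, `tools/kfamily_g1child2.py` over the kspeel runs `data/ks{4,6}_C` and the
gs-eng-2 g54 kit job j318002 peel tables ◇₈ sha16 a459e02921a60310 / ◇₁₀ 74004db439790926; SAT verdicts from gs-eng-2 g55
`g55/residual/h8/census.json` and `g55/residual/census.json` 54e0e087dcd02cd5).  Let `G_h` = the orbits of `P`-cells of ◇_h satisfying the
hypotheses of the second-child theorem for some `g ∈ ⟨S₄, Δ⟩` (enumerated mechanically: 96 group elements per cell).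
(a) AT ◇_h EVERY MEMBER OF `G_h` IS PEEL ROUND 1 — |G_h| = 15, 26, 40, 57 for h = 4, 6, 8, 10 (138 ∕ 138 round 1, kind `P(:Xp)`; `= (3k+4)(k+1)/2`,
    `k = h/2`); the pure sub-family A alone: 6, 10, 15, 21 orbits, each with `nprop = 2` = exactly the two steps of §1; all 29 (◇₈) ∕ 44 (◇₁₀) round-1
    orbits with `nprop = 2` in the j318002 tables lie in `G_h`.  NOT covered and NOT round 1: the equal ∕ antipodal ceiling pairs `P[aI|6I+l-1|6I+l∓1|8I]`
    (◇₈ rounds 7–15) and the equal floor pairs `P[l-1|l-1|6I+l_χ|8I]` (rounds 4–5) — there the hypothesis «a second child exists» fails.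
(b) ONE DIAMOND UP THE FATE FLIPS FOR EXACTLY ONE MEMBER — seen inside ◇_{h+2}, the triple-apex member `P{(h−2)I+ℓ_χ, hI, hI, hI}` is the UNIQUE
    member of `G_h` that survives unit propagation (4→6: `P[2I+l-1|4I|4I|4I]`, 1 ∕ 15; 6→8: `P[4I+l-1|6I|6I|6I]`, j318002 var 97044 round 0, 1 ∕ 26;
    8→10: `P[6I+l-1|8I|8I|8I]`, var 432386 round 0, 1 ∕ 40) and it is REALISABLE there (present in some G₁-closed H₁-static design: ◇₆ —
    `data/resid6.cnf.backbone` «free»; ◇₈ — g55 `h8/census.json` verdict SAT; ◇₁₀ — g55 `census.json` verdict SAT); the other members die UP only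
    in LATE rounds (◇₆: 3–6; ◇₈: 3–13; ◇₁₀: 4–25), i.e. no longer law-free.  PREDICTION for the ◇₁₂ census: |G_12| = 77, all round 1;
    of `G_10` exactly `P[8I+l-1|10I|10I|10I]` survives the ◇₁₂ peel, and it is SAT.
So §1 is a theorem-certified NON-MONOTONICITY WITNESS FAMILY for cell-wise absence along the diamond tower: absent at ◇_h by a boundary
certificate, present in a static design of ◇_{h+2} (h = 4, 6, 8) — the typed form of memo §14's warning that rung statements about `K`-absence
must quantify cells RELATIVE TO THE BOUNDARY (transport shape, `DiamondRestrict.lean`), never as a fixed cell list.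
WHAT IS NOT PROVED: realisability at ◇_{h+2} (census only: a design exhibit would need a `decide` certificate in the `Pad4TowerLineDesignCert8`
format); anything about the late-round deaths of the other members; any statement at the summit.
-/

set_option linter.dupNamespace false
set_option linter.unusedSimpArgs false

namespace Summit.HodgeConjecture.HodgeConjecture.Cruxes.BlochSeedDiscOne.CeilingUnitApex

open Finset Summit.Ventures.HSemireg.Pad4Tower
open Summit.HodgeConjecture.HodgeConjecture.Cruxes.BlochSeedDiscOne.DiamondLevelLaws

/-! ## §0 Restated verbatim from `CeilingFork.lean` §1–§3 (control g18; that module is not built on the farm, hence not importable here) -/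

/-- the unit ceiling letter `(h−2)I + ℓ_χ` (`α = h − 1`, `c = 1`, node `h − 2`, causal top `h`) — `= CeilingFork.ceilingUnit`. -/
abbrev ceilingUnit (h : ℤ) (χ : Fin 4) : BPoint := ray ((h - 2, 0, 0) : BPoint) χ 1

theorem ceilingUnit_not_isApex (h : ℤ) (χ : Fin 4) : ¬ isApex (ceilingUnit h χ) := by
  fin_cases χ <;> simp [ray, isApex]

theorem ceilingUnit_fst (h : ℤ) (χ : Fin 4) : (ceilingUnit h χ).1 = h - 1 := by
  fin_cases χ <;> simp [ray] <;> omega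

/-- the NODE direction of `(h−2)I + ℓ_χ` is `χ + 2`, with coordinate `h − 2`. -/
theorem ceilingUnit_node (h : ℤ) (χ : Fin 4) : Adapted (ceilingUnit h χ) (χ + 2) ∧ coord (ceilingUnit h χ) (χ + 2) = h - 2 := by
  fin_cases χ <;> simp [ray, coord, Adapted]

/-- one step up the node direction from `(h−2)I + ℓ_χ` is the ceiling apex `hI`. -/
theorem ceilingApex_eq_ray_ceilingUnit (h : ℤ) (χ : Fin 4) : ((h, 0, 0) : BPoint) = ray (ceilingUnit h χ) (χ + 2) 1 := by
  fin_cases χ <;> simp [ray] <;> omega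


/-- **ABOVE A UNIT CEILING LETTER THERE IS ONLY `hI`, ALONG THE NODE DIRECTION** (KERNEL): a point of ◇_h strictly null-above `(h−2)I + ℓ_χ`
in direction `r` is the apex `hI`, and `r = χ + 2`. -/
theorem above_ceilingUnit {h : ℤ} {y : BPoint} (hy : InDiamond h y) {χ r : Fin 4} {e : ℤ} (he0 : 0 < e)
    (he : y = ray (ceilingUnit h χ) r e) : r = χ + 2 ∧ y = (h, 0, 0) := by
  subst he
  obtain ⟨hax, h1, -, h3⟩ := hy
  simp only [AxisPt, absCharge, chargeOf, ray, Prod.mk.injEq] at hax h1 h3 ⊢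
  fin_cases χ <;> fin_cases r <;> simp at hax h1 h3 ⊢ <;>
    (simp only [abs_eq_max_neg, max_def] at h1 h3; split_ifs at h1 h3 <;> omega)


theorem deltaPt_ceilingUnit (h : ℤ) (χ : Fin 4) : deltaPt (ceilingUnit h χ) = ceilingUnit h (χ + 3) := by
  fin_cases χ <;> simp [ray, deltaPt]

theorem deltaPt_apex (a : ℤ) : deltaPt ((a, 0, 0) : BPoint) = (a, 0, 0) := by
  simp [deltaPt]

theorem fin4_add3_ne (χ : Fin 4) : χ + 3 ≠ χ := by fin_cases χ <;> decide

/-- **THE UNIT FORK** (KERNEL, every `h`, law-free): an `N`-cell `Z` with two ceiling apices `Z g = Z f = hI` cannot have two `P`-children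
`P₁ = Z(g ↦ y₁)`, `P₂ = Z(g ↦ y₂)` at DISTANCE ONE below the apex (`α(yᵢ) = h − 1`) in two different null directions.  This is
`xplus_two_children_gen` with its no-twin side condition `hNT` DISCHARGED: both uses of `hNT` concern `N`-twins strictly between a child and the
apex, and there is no lattice level strictly between `h − 1` and `h`. -/
theorem xplus_unit_fork {h : ℤ} {C : MConfig} (hU : C.InDiamond h) (hX : XPlusClosed C) {Z : MCell} (hZ : Z ∈ C.lower)
    {g f : Fin 4} (hfg : f ≠ g) (hg : Z g = (h, 0, 0)) (hf : Z f = (h, 0, 0)) {P₁ P₂ : MCell}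
    (hP₁ : P₁ ∈ C.upper) (hP₂ : P₂ ∈ C.upper) {r₁ r₂ : Fin 4} (hr : r₂ ≠ r₁) (h1 : UPartner Z P₁ g r₁) (h2 : UPartner Z P₂ g r₂)
    (hd₁ : (P₁ g).1 = h - 1) (hd₂ : (P₂ g).1 = h - 1) : False := by
  have hZg1 : (Z g).1 = h := by rw [hg]
  have h1ray : ((h, 0, 0) : BPoint) = ray (P₁ g) r₁ (h - (P₁ g).1) := by have := h1.2.2; rw [hg] at this; exact this
  refine hX (dualCell 0 P₁) (dualCell_mem_dual_lower hP₁) (dualCell 0 Z) (dualCell_mem_dual_upper hZ) (dualCell 0 P₂)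
    (dualCell_mem_dual_lower hP₂) g r₁ r₂ f ⟨?_, hfg, (uPartner_dual 0 Z P₁ g r₁).mpr h1, ?_, hr, ?_, ?_, ?_, ?_, ?_⟩
  · -- `(P₁ g)^∨` is charged: `P₁ g` is a child of the apex `hI`
    exact fun hap => not_isApex_below_apex (by omega) h1ray ((isApex_dual 0 (P₁ g)).mp hap)
  · -- topmost partner: an `N`-twin strictly between `P₁ g` and `hI` would live at a level strictly between `h − 1` and `h`
    intro P hP hPu
    obtain ⟨X, hXl, rfl⟩ := Finset.mem_image.mp hP
    have hu : UPartner X P₁ g r₁ := (uPartner_dual 0 X P₁ g r₁).mp hPu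
    show 0 - (X g).1 ≤ 0 - (Z g).1
    have hlt : (P₁ g).1 < (X g).1 := hu.2.1
    have hle : (X g).1 ≤ h := fst_le_of_inDiamond (hU.1 X hXl g)
    omega
  · -- `P₂^∨` is an `r₂`-sibling of `Z^∨`
    exact ⟨magree_dual.mpr (fun j hj => (h2.1 j hj).symm), (ray_dual_iff 0 (Z g) (P₂ g) r₂).mpr ⟨h2.2.1, h2.2.2⟩⟩
  · -- no companion: a companion strictly between `P₂ g` and `hI` would live at a level strictly between `h − 1` and `h`
    intro P hP _ hlt1 hlt2 _
    obtain ⟨X, hXl, rfl⟩ := Finset.mem_image.mp hP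
    exfalso
    change 0 - (Z g).1 < 0 - (X g).1 at hlt1
    change 0 - (X g).1 < 0 - (P₂ g).1 at hlt2
    have hle : (X g).1 ≤ h := fst_le_of_inDiamond (hU.1 X hXl g)
    omega
  · -- `HeOkP⁺`: every letter of ◇_h lies causally below `hI`
    intro P hP _ _ _ _
    obtain ⟨X, hXl, rfl⟩ := Finset.mem_image.mp hP
    show Effective (bsub (dualPt 0 (X g)) (dualPt 0 (Z g)))
    rw [bsub_dualPt0, hg]
    exact effective_ceilingApex_sub (hU.1 X hXl g)
  · -- `HbOkP⁺`: vacuous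
    intro P hP _ hnb _
    obtain ⟨X, hXl, rfl⟩ := Finset.mem_image.mp hP
    exfalso
    have e1 : (P₁ f).1 = h := by rw [(h1.1 f hfg).trans hf]
    have := hnb.1
    change 0 - (X f).1 < 0 - (P₁ f).1 at this
    have hle := fst_le_of_inDiamond (hU.1 X hXl f)
    omega
  · -- `WfEmpty⁺`: vacuous
    intro P hP hnb
    obtain ⟨X, hXl, rfl⟩ := Finset.mem_image.mp hP
    exfalso
    have e1 : (P₁ f).1 = h := by rw [(h1.1 f hfg).trans hf]
    have := hnb.1
    change 0 - (X f).1 < 0 - (P₁ f).1 at this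
    have hle := fst_le_of_inDiamond (hU.1 X hXl f)
    omega

/-- **LIFT** (KERNEL, every `h`; RULE D at the `P`-cell = `upLine_of_ruleDMu4P` + `above_ceilingUnit`): a `P`-cell `P` of a RULE-D-closed design
in ◇_h with a ceiling letter on slot `a` and the unit ceiling letter `(h−2)I + ℓ_χ` on slot `d ≠ a` has the `N`-parent `P(d ↦ hI)` present, as a
`(χ+2)`-partner. -/
theorem lift_of_ceilingUnit {h : ℤ} {C : MConfig} (hU : C.InDiamond h) {P : MCell} (hP : P ∈ C.upper) (hD : RuleDMu4P C P)
    {a d : Fin 4} (had : a ≠ d) (hac : OnCeiling h (P a)) {χ : Fin 4} (hd : P d = ceilingUnit h χ) :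
    ∃ N ∈ C.lower, UPartner N P d (χ + 2) ∧ N d = (h, 0, 0) := by
  have hna : ¬ isApex (P d) := by rw [hd]; exact ceilingUnit_not_isApex h χ
  have hk : Adapted (P d) (χ + 2) := by rw [hd]; exact (ceilingUnit_node h χ).1
  have hkh : coord (P d) (χ + 2) ≠ h := by rw [hd, (ceilingUnit_node h χ).2]; omega
  obtain ⟨N, hN, hNP⟩ := upLine_of_ruleDMu4P hU hP hD had hac hna hk hkh
  have he0 : 0 < (N d).1 - (P d).1 := by have := hNP.2.1; omega
  have e : N d = ray (ceilingUnit h χ) (χ + 2) ((N d).1 - (P d).1) := by rw [← hd]; exact hNP.2.2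
  exact ⟨N, hN, hNP, (above_ceilingUnit (hU.1 N hN d) he0 e).2⟩

/-! ## §1 THE SECOND-CHILD THEOREM and the APEX CEILING-UNIT FAMILY (law-free, every `h`) -/

/-- **THE SECOND-CHILD THEOREM** (KERNEL, every `h`, law-free).  Let the `P`-cell `Z` carry the unit ceiling letter `(h−2)I + ℓ_χ` on slot `d` and
the ceiling apex `hI` on a slot `f ≠ d`, and let `Z'` be a cell that agrees with `Z` off `d`, carries a DIFFERENT unit ceiling letter `(h−2)I + ℓ_χ'`
on `d`, and is present whenever `Z` is (in a `G₁`-closed design: `Z' = g • Z` for a `g ∈ G₁ = ⟨S₄, Δ⟩`).  Then `Z` is ABSENT from every two-level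
design in ◇_h whose `P`-level obeys RULE D and which obeys the X⁺ law.  Two steps: RULE D (P) at the pair (apex at `f`, node `h−2` at `d`) forces the
LIFT `X = Z(d ↦ hI) ∈ C.lower` at distance one (`lift_of_ceilingUnit`); `Z`, `Z'` are two distance-one children of `X` at `d` in the directions
`χ+2 ≠ χ'+2`, and `X d = X f = hI`; `xplus_unit_fork` ⇒ ⊥. -/
theorem apexCeilingUnit_absent_of_secondChild {h : ℤ} {C : MConfig} (hU : C.InDiamond h) (hDP : ∀ P ∈ C.upper, RuleDMu4P C P)
    (hX : XPlusClosed C) {Z Z' : MCell} {d f : Fin 4} (hfd : f ≠ d) {χ χ' : Fin 4} (hχ : χ' ≠ χ)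
    (hd : Z d = ceilingUnit h χ) (hf : Z f = (h, 0, 0)) (hZ' : Z ∈ C.upper → Z' ∈ C.upper) (hagree : ∀ j, j ≠ d → Z' j = Z j)
    (hd' : Z' d = ceilingUnit h χ') : Z ∉ C.upper := fun hZ => by
  -- step 1: the lift
  obtain ⟨X, hXl, hXZ, hXd⟩ := lift_of_ceilingUnit hU hZ (hDP Z hZ) hfd (by rw [hf]; exact onCeiling_apex h) hd
  have hXf : X f = (h, 0, 0) := (hXZ.1 f hfd).symm.trans hf
  -- step 2: the second child and the unit fork
  have u2 : UPartner X Z' d (χ' + 2) := by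
    refine ⟨fun j hj => ?_, ?_, ?_⟩
    · rw [hagree j hj]; exact hXZ.1 j hj
    · rw [hd', ceilingUnit_fst, hXd]; omega
    · rw [hd', hXd, ceilingUnit_fst, show h - (h - 1) = 1 by ring]
      exact ceilingApex_eq_ray_ceilingUnit h χ'
  have hr : χ' + 2 ≠ χ + 2 := fun e => hχ (add_right_cancel e)
  have hd₁ : (Z d).1 = h - 1 := by rw [hd, ceilingUnit_fst]
  have hd₂ : (Z' d).1 = h - 1 := by rw [hd', ceilingUnit_fst]
  exact xplus_unit_fork hU hX hXl hfd hXd hXf hZ (hZ' hZ) hr hXZ u2 hd₁ hd₂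

/-- `Δ⁴ = 1` on points. -/
theorem deltaPt_pow4 (y : BPoint) : deltaPt (deltaPt (deltaPt (deltaPt y))) = y := by
  obtain ⟨a, b, c⟩ := y
  simp [deltaPt]

theorem fin4_add33_ne (χ : Fin 4) : χ + 3 + 3 ≠ χ := by fin_cases χ <;> decide
theorem fin4_add333_ne_add3 (ψ : Fin 4) : ψ + 3 + 3 + 3 ≠ ψ + 3 := by fin_cases ψ <;> decide
theorem fin4_add3333 (ψ : Fin 4) : ψ + 3 + 3 + 3 + 3 = ψ := by fin_cases ψ <;> decide

/-- **SUB-FAMILY A — Δ-FIXED OFF `d`** (the census family `P{(h−2)I+ℓ_χ, hI, y, y′}` with `y, y′` pure letters `aI`): the second child is `Δ Z`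
(the `P`-level is `Δ`-closed).  Used: RULE D (P), X⁺, `Δ` on the `P`-level; NOT used: RULE D (N), A2I⁻, `S₄`, any level law, parity of `h`. -/
theorem apexCeilingUnitFamily_absent {h : ℤ} {C : MConfig} (hU : C.InDiamond h) (hDP : ∀ P ∈ C.upper, RuleDMu4P C P)
    (hX : XPlusClosed C) (hΔu : DeltaClosed C.upper) {Z : MCell} {d f : Fin 4} (hfd : f ≠ d) {χ : Fin 4}
    (hd : Z d = ceilingUnit h χ) (hf : Z f = (h, 0, 0)) (hpure : ∀ j, j ≠ d → deltaPt (Z j) = Z j) : Z ∉ C.upper :=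
  have d1 : ∀ j, Z.delta j = deltaPt (Z j) := fun _ => rfl
  apexCeilingUnit_absent_of_secondChild hU hDP hX hfd (fin4_add3_ne χ) hd hf (hΔu Z) (fun j hj => by rw [d1, hpure j hj])
    (by rw [d1, hd, deltaPt_ceilingUnit])

/-- **SUB-FAMILY B — AN ANTIPODAL PAIR** `P{x, Δ²x, (h−2)I+ℓ_χ, hI}` (slots 0, 1, 2, 3; `x` ARBITRARY, e.g. `c·ℓ_φ + aI` paired with `c·ℓ_{φ+2} + aI`;
the census orbits `P[l-1|l1|6I+l_χ|8I]`, `P[2l-1|2l1|…]`, `P[2I+l-1|2I+l1|…]`, `P[4l-1|4l1|…]`, `P[2I+3l-1|2I+3l1|…]`, `P[4I+2l-1|4I+2l1|…]` of ◇₈, every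
`χ`): the second child is the slot swap `(0 1)` of `Δ² Z` (the `P`-level is `S₄`- and `Δ`-closed).  Other slot orders follow from `PermClosed`, not restated. -/
theorem antipodalPair_apexCeilingUnit_absent {h : ℤ} {C : MConfig} (hU : C.InDiamond h) (hDP : ∀ P ∈ C.upper, RuleDMu4P C P)
    (hX : XPlusClosed C) (hGu : PermClosed C.upper) (hΔu : DeltaClosed C.upper) {Z : MCell} {χ : Fin 4}
    (h1 : Z 1 = deltaPt (deltaPt (Z 0))) (h2 : Z 2 = ceilingUnit h χ) (h3 : Z 3 = (h, 0, 0)) : Z ∉ C.upper := by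
  have d1 : ∀ Q : MCell, ∀ j, Q.delta j = deltaPt (Q j) := fun _ _ => rfl
  have e : ∀ j, (Z.delta.delta).perm (Equiv.swap 0 1) j = deltaPt (deltaPt (Z (Equiv.swap (0 : Fin 4) 1 j))) := fun j => by
    rw [MCell.perm_apply, d1, d1]
  refine apexCeilingUnit_absent_of_secondChild hU hDP hX (d := 2) (f := 3) (by decide) (fin4_add33_ne χ) h2 h3
    (Z' := (Z.delta.delta).perm (Equiv.swap 0 1)) (fun hZ => hGu _ _ (hΔu _ (hΔu Z hZ))) (fun j hj => ?_) ?_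
  · rw [e]
    fin_cases j
    · show deltaPt (deltaPt (Z 1)) = Z 0
      rw [h1, deltaPt_pow4]
    · show deltaPt (deltaPt (Z 0)) = Z 1
      rw [h1]
    · exact absurd rfl hj
    · show deltaPt (deltaPt (Z 3)) = Z 3
      rw [h3, deltaPt_apex, deltaPt_apex]
  · rw [e]
    show deltaPt (deltaPt (Z 2)) = ceilingUnit h (χ + 3 + 3)
    rw [h2, deltaPt_ceilingUnit, deltaPt_ceilingUnit]

/-- **SUB-FAMILY C — TWO ADJACENT UNIT CEILING LETTERS** `P{aI, (h−2)I+ℓ_ψ, (h−2)I+ℓ_{ψ+3}, hI}` (slots 0, 1, 2, 3; the census orbits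
`P[O|6I+l-1|6I+li|8I]`, `P[2I|…]`, `P[4I|…]`, `P[6I|6I+l-1|6I+li|8I]` of ◇₈): the second child (at slot 2) is the slot swap `(1 2)` of `Δ³ Z`.  The
antipodal ∕ equal pairs `P[aI|6I+l-1|6I+l1|8I]`, `P[aI|6I+l-1|6I+l-1|8I]` are NOT covered (no `G₁`-second child; census: ◇₈ rounds 7–15, not 1). -/
theorem adjacentCeilingPair_absent {h : ℤ} {C : MConfig} (hU : C.InDiamond h) (hDP : ∀ P ∈ C.upper, RuleDMu4P C P)
    (hX : XPlusClosed C) (hGu : PermClosed C.upper) (hΔu : DeltaClosed C.upper) {Z : MCell} {a : ℤ} {ψ : Fin 4}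
    (h0 : Z 0 = (a, 0, 0)) (h1 : Z 1 = ceilingUnit h ψ) (h2 : Z 2 = ceilingUnit h (ψ + 3)) (h3 : Z 3 = (h, 0, 0)) : Z ∉ C.upper := by
  have d1 : ∀ Q : MCell, ∀ j, Q.delta j = deltaPt (Q j) := fun _ _ => rfl
  have e : ∀ j, (Z.delta.delta.delta).perm (Equiv.swap 1 2) j = deltaPt (deltaPt (deltaPt (Z (Equiv.swap (1 : Fin 4) 2 j)))) :=
    fun j => by rw [MCell.perm_apply, d1, d1, d1]
  refine apexCeilingUnit_absent_of_secondChild hU hDP hX (d := 2) (f := 3) (by decide) (fin4_add333_ne_add3 ψ) h2 h3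
    (Z' := (Z.delta.delta.delta).perm (Equiv.swap 1 2)) (fun hZ => hGu _ _ (hΔu _ (hΔu _ (hΔu Z hZ)))) (fun j hj => ?_) ?_
  · rw [e]
    fin_cases j
    · show deltaPt (deltaPt (deltaPt (Z 0))) = Z 0
      rw [h0, deltaPt_apex, deltaPt_apex, deltaPt_apex]
    · show deltaPt (deltaPt (deltaPt (Z 2))) = Z 1
      rw [h2, h1, deltaPt_ceilingUnit, deltaPt_ceilingUnit, deltaPt_ceilingUnit, fin4_add3333]
    · exact absurd rfl hj
    · show deltaPt (deltaPt (deltaPt (Z 3))) = Z 3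
      rw [h3, deltaPt_apex, deltaPt_apex, deltaPt_apex]
  · rw [e]
    show deltaPt (deltaPt (deltaPt (Z 1))) = ceilingUnit h (ψ + 3 + 3 + 3)
    rw [h1, deltaPt_ceilingUnit, deltaPt_ceilingUnit, deltaPt_ceilingUnit]

/-- **PACKAGED over the typed static predicates of record** (`StaticH1 = RuleDMu4Closed ∧ XPlusClosed ∧ A2IMinusClosed`, `G1Closed`), sub-family A. -/
theorem apexCeilingUnitFamily_absent_static {h : ℤ} {C : MConfig} (hU : C.InDiamond h) (hG : C.G1Closed) (hS : C.StaticH1)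
    {Z : MCell} {d f : Fin 4} (hfd : f ≠ d) {χ : Fin 4} (hd : Z d = ceilingUnit h χ) (hf : Z f = (h, 0, 0))
    (hpure : ∀ j, j ≠ d → deltaPt (Z j) = Z j) : Z ∉ C.upper :=
  apexCeilingUnitFamily_absent hU hS.1.2 hS.2.1 hG.2.2.2 hfd hd hf hpure

/-- packaged, sub-family B. -/
theorem antipodalPair_apexCeilingUnit_absent_static {h : ℤ} {C : MConfig} (hU : C.InDiamond h) (hG : C.G1Closed) (hS : C.StaticH1)
    {Z : MCell} {χ : Fin 4} (h1 : Z 1 = deltaPt (deltaPt (Z 0))) (h2 : Z 2 = ceilingUnit h χ) (h3 : Z 3 = (h, 0, 0)) : Z ∉ C.upper :=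
  antipodalPair_apexCeilingUnit_absent hU hS.1.2 hS.2.1 hG.2.1 hG.2.2.2 h1 h2 h3

/-- packaged, sub-family C. -/
theorem adjacentCeilingPair_absent_static {h : ℤ} {C : MConfig} (hU : C.InDiamond h) (hG : C.G1Closed) (hS : C.StaticH1) {Z : MCell}
    {a : ℤ} {ψ : Fin 4} (h0 : Z 0 = (a, 0, 0)) (h1 : Z 1 = ceilingUnit h ψ) (h2 : Z 2 = ceilingUnit h (ψ + 3)) (h3 : Z 3 = (h, 0, 0)) :
    Z ∉ C.upper :=
  adjacentCeilingPair_absent hU hS.1.2 hS.2.1 hG.2.1 hG.2.2.2 h0 h1 h2 h3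

/-- the TRIPLE-APEX member `P{(h−2)I+ℓ_χ, hI, hI, hI}` (slot 0 the unit ceiling letter): absent at ◇_h for every `h` — and, by the census, the
unique member of the whole family that is realisable again at ◇_{h+2} (h = 4, 6, 8). -/
theorem apexTriple_absent_static {h : ℤ} {C : MConfig} (hU : C.InDiamond h) (hG : C.G1Closed) (hS : C.StaticH1) {Z : MCell} {χ : Fin 4}
    (h0 : Z 0 = ceilingUnit h χ) (h1 : Z 1 = (h, 0, 0)) (h2 : Z 2 = (h, 0, 0)) (h3 : Z 3 = (h, 0, 0)) : Z ∉ C.upper :=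
  apexCeilingUnitFamily_absent_static hU hG hS (d := 0) (f := 1) (by decide) h0 h1 fun j hj => by
    fin_cases j
    · exact absurd rfl hj
    · show deltaPt (Z 1) = Z 1; rw [h1, deltaPt_apex]
    · show deltaPt (Z 2) = Z 2; rw [h2, deltaPt_apex]
    · show deltaPt (Z 3) = Z 3; rw [h3, deltaPt_apex]

/-! ## §2 Census representatives are instances (encoder coordinates: `ℓ_{-1} = (1,−1,0)`, `(h−2)I+ℓ_{-1} = (h−1,−1,0)`, `hI = (h,0,0)`) -/

/-- ◇₆: `P[4I+l-1|6I|6I|6I]` (control g19 kspeel ◇₆ var 15888: round 1, kind P, nprop 2; one diamond UP it is j318002 ◇₈ var 97044, round 0 =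
survivor, and g55 `h8/census.json` verdict SAT). -/
def censusTriple6 : MCell := ![((5, -1, 0) : BPoint), (6, 0, 0), (6, 0, 0), (6, 0, 0)]

/-- ◇₈: `P[6I+l-1|8I|8I|8I]` (j318002 ◇₈ var 97658: round 1, `P:Xp`, nprop 2; one diamond UP it is ◇₁₀ var 432386, round 0 = survivor, and g55
`census.json` verdict SAT). -/
def censusTriple8 : MCell := ![((7, -1, 0) : BPoint), (8, 0, 0), (8, 0, 0), (8, 0, 0)]

/-- ◇₈, a non-triple member: `P[O|O|6I+l-1|8I]` (j318002 ◇₈ var 548: round 1, `P:Xp`, nprop 2; one diamond UP it dies only in round 12). -/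
def censusPair8 : MCell := ![((0, 0, 0) : BPoint), (0, 0, 0), (7, -1, 0), (8, 0, 0)]

/-- ◇₁₀: `P[8I+l-1|10I|10I|10I]` (j318002 ◇₁₀ var 433000: round 1, `P:Xp`, nprop 2; PREDICTION: survivor and realisable at ◇₁₂). -/
def censusTriple10 : MCell := ![((9, -1, 0) : BPoint), (10, 0, 0), (10, 0, 0), (10, 0, 0)]

theorem censusTriple6_absent {C : MConfig} (hU : C.InDiamond 6) (hG : C.G1Closed) (hS : C.StaticH1) : censusTriple6 ∉ C.upper :=
  apexTriple_absent_static hU hG hS (χ := 2) (by simp [censusTriple6, ray]) (by simp [censusTriple6]) (by simp [censusTriple6])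
    (by simp [censusTriple6])

theorem censusTriple8_absent {C : MConfig} (hU : C.InDiamond 8) (hG : C.G1Closed) (hS : C.StaticH1) : censusTriple8 ∉ C.upper :=
  apexTriple_absent_static hU hG hS (χ := 2) (by simp [censusTriple8, ray]) (by simp [censusTriple8]) (by simp [censusTriple8])
    (by simp [censusTriple8])

theorem censusTriple10_absent {C : MConfig} (hU : C.InDiamond 10) (hG : C.G1Closed) (hS : C.StaticH1) : censusTriple10 ∉ C.upper :=
  apexTriple_absent_static hU hG hS (χ := 2) (by simp [censusTriple10, ray]) (by simp [censusTriple10]) (by simp [censusTriple10])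
    (by simp [censusTriple10])

theorem censusPair8_absent {C : MConfig} (hU : C.InDiamond 8) (hG : C.G1Closed) (hS : C.StaticH1) : censusPair8 ∉ C.upper :=
  apexCeilingUnitFamily_absent_static hU hG hS (d := 2) (f := 3) (by decide) (χ := 2) (by simp [censusPair8, ray]) (by simp [censusPair8])
    fun j hj => by
      fin_cases j
      · simp [censusPair8, deltaPt]
      · simp [censusPair8, deltaPt]
      · exact absurd rfl hj
      · simp [censusPair8, deltaPt]

/-- ◇₈, sub-family B: `P[l-1|l1|6I+l-1|8I]` (j318002 ◇₈ var 12750: round 1, `P:Xp`, nprop 2; `ℓ_1 = (1,1,0) = Δ² ℓ_{-1}`). -/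
def censusAntipodal8 : MCell := ![((1, -1, 0) : BPoint), (1, 1, 0), (7, -1, 0), (8, 0, 0)]

/-- ◇₈, sub-family C: `P[O|6I+l-1|6I+li|8I]` (j318002 ◇₈ var 8204: round 1, `P:Xp`, nprop 2; `6I+ℓ_i = (7,0,−1) = (h−2)I+ℓ_{2+3}`). -/
def censusAdjacent8 : MCell := ![((0, 0, 0) : BPoint), (7, -1, 0), (7, 0, -1), (8, 0, 0)]

theorem censusAntipodal8_absent {C : MConfig} (hU : C.InDiamond 8) (hG : C.G1Closed) (hS : C.StaticH1) : censusAntipodal8 ∉ C.upper :=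
  antipodalPair_apexCeilingUnit_absent_static hU hG hS (χ := 2) (by simp [censusAntipodal8, deltaPt]) (by simp [censusAntipodal8, ray])
    (by simp [censusAntipodal8])

theorem censusAdjacent8_absent {C : MConfig} (hU : C.InDiamond 8) (hG : C.G1Closed) (hS : C.StaticH1) : censusAdjacent8 ∉ C.upper :=
  adjacentCeilingPair_absent_static hU hG hS (a := 0) (ψ := 2) (by simp [censusAdjacent8]) (by simp [censusAdjacent8, ray])
    (by simp [censusAdjacent8, ray]) (by simp [censusAdjacent8])

end Summit.HodgeConjecture.HodgeConjecture.Cruxes.BlochSeedDiscOne.CeilingUnitApex
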